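import Literature.IUT.LogVolume.Corollary22PartIIPointwise
import Literature.IUT.LogVolume.Corollary22Thm110LegendreWitness
import Literature.IUT.LogVolume.PrimeNumberEstimates
import HarnessLib

/-!
# [IUTchIV] Corollary 2.2 (ii), prime-choice step (p. 44): the data record `Cor22.PrimeChoiceData`
# IS INSTANTIATED — at the genuine point-level data of an NF-point of large `q`-height

S. Mochizuki, *Inter-universal Teichmüller theory IV*, §2, proof of Corollary 2.2 (ii), p. 44 (kurims
manuscript) [claim: Mochizuki2012, status: disputed]. PROOF-ONLY companion of
`Literature/IUT/LogVolume/Corollary22PrimeChoice.lean` (statement module: `Cor22.PrimeChoiceData`, its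
consequence `PrimeChoiceData.exists_prime_P1_P2_P3`) — NO new definition, instance or structure.

NON-VACUITY (cell abc-iut, ADJUDICATION §4 (iii) «instantiated ≠ endorsed»; whole-cell kernel
inhabitation census v3, w5-d056 04:19Z: `Cor22.PrimeChoiceData` — 22 consumers — had NO named producer;
its only instance lived inline inside the proof of `Cor22.exists_prime_P1_P2_P3_point`, under the two
hypotheses `hξ : IsXiPrm ξ` and `hξh : ξ ≤ (log q^∀(λ))^{1/2}`). Here the record is produced BY NAME and
UNCONDITIONALLY, at GENUINE data:

* `PrimeChoiceData.exists_model_of_point` — for every NF-point `λ` and every `ξ_prm` of Prop. 2.1 (ii) with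
  `ξ_prm ≤ (log q^∀(λ))^{1/2}` (the standing assumption "`h^{1/2} ≥ ξ_prm`" of p. 44): a `PrimeChoiceData`
  with `h = log(q^∀(λ))`, `d = [F_tpd : ℚ]`, `δ = 2^{12}·3^3·5·d`, `ξ = ξ_prm`, and (in the term) `V` = the bad
  places of `λ`, `h_v = max(0, −ord_v j(λ))`, `f_v`, `p_v` the residue degrees/characteristics — exactly the
  bookkeeping of p. 44 (the term is the one of `exists_prime_P1_P2_P3_point`, abc-iut S lineage, now named);
* `PrimeChoiceData.exists_model` — UNCONDITIONAL: by `exists_isXiPrm` (Prop. 2.1 (ii), PROVED in the tree from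
  `ϑ(x) ∼ x`) and `Cor22.exists_hypotheses_unbounded_logQForall` (abc-iut-S-d3: degree-`1` points of the
  compactly bounded subset of record with arbitrarily large `log(q^∀)`), some NF-point `λ ∈ U_X` of degree
  `≤ 1` carries such a datum with `ξ = ξ_prm`;
* `PrimeChoiceData.nonempty_model : Nonempty PrimeChoiceData`.

Honest label: GENUINE model (`_model`): the data of an actual NF-rational point of the once-punctured
elliptic curve family, not a toy carrier. Nothing here bears on the disputed parts of the series; typed ≠
proved; no side taken on [IUTchIII] Cor. 3.12.
-/

namespace Literature.IUT.LogVolume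

namespace Cor22

open NumberField IsDedekindDomain Literature.NumberTheory.DiophantineGeometry.GenEll Real Finset

namespace PrimeChoiceData

open scoped Classical in
/-- **The prime-choice data AT A POINT** ([IUTchIV] proof of Cor. 2.2 (ii), p. 44): for an NF-point `λ`
and `ξ_prm` as in Prop. 2.1 (ii) with `ξ_prm ≤ (log q^∀(λ))^{1/2}`, the record with `V` = the bad places of
`λ`, `h_v = max(0, −ord_v j(λ))`, `f_v`, `p_v`, `d = [F_tpd:ℚ] ≤ δ = 2^{12}·3^3·5·d`, `h = log(q^∀(λ))`,
`[F_tpd:ℚ]·h = Σ_v h_v·f_v·log(p_v)` — produced by name (fields `h`, `d`, `δ`, `ξ` exposed).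
[claim: Mochizuki2012, status: disputed] -/
theorem exists_model_of_point (P : NFPoint) {ξ : ℝ} (hξ : IsXiPrm ξ)
    (hξh : ξ ≤ Real.sqrt (logQForall P)) :
    ∃ A : PrimeChoiceData, A.h = logQForall P ∧ A.d = P.degree ∧ A.δ = delta P.degree ∧ A.ξ = ξ := by
  let A : PrimeChoiceData :=
    { ι := HeightOneSpectrum (𝓞 P.F)
      instDecEq := inferInstance
      V := badPlaces P
      hv := fun v => (-(ord P.F v (jInv P.x))).toNat
      fv := fun v => resDeg P.F v
      one_le_fv := fun v _ => Nat.pos_of_ne_zero (resDeg_ne_zero P.F v)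
      pv := fun v => residueChar P.F v
      pv_prime := fun v _ => residueChar_prime P.F v
      d := P.degree
      one_le_d := P.degree_pos
      δ := delta P.degree
      two_le_δ := by
        have h1 : (1 : ℝ) ≤ P.degree := by exact_mod_cast P.degree_pos
        unfold delta; nlinarith
      d_le_δ := by
        have h1 : (1 : ℝ) ≤ P.degree := by exact_mod_cast P.degree_pos
        unfold delta; nlinarith
      h := logQForall P
      h_def := by
        rw [degree_mul_logQForall_eq_sum_logNorm]
        refine Finset.sum_congr rfl fun v _ => ?_
        unfold localHeight
        rw [logNorm_eq]
        ring
      ξ := ξ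
      isXiPrm := hξ
      ξ_le_sqrt := hξh }
  exact ⟨A, rfl, rfl, rfl, rfl⟩

/-- **UNCONDITIONAL genuine instance** of the prime-choice data: some NF-point `λ ∈ U_X` of degree `≤ 1`
(in the compactly bounded subset of record `CBData.std {2}`, which satisfies `Cor22.Hypotheses`) has
`log(q^∀(λ)) ≥ ξ_prm²` for a `ξ_prm` of Prop. 2.1 (ii), hence carries a `PrimeChoiceData` with
`h = log(q^∀(λ))`. Inputs BY NAME: `exists_isXiPrm` (Prop. 2.1 (ii), proved) and
`Cor22.exists_hypotheses_unbounded_logQForall` (abc-iut-S-d3). [claim: Mochizuki2012, status: disputed] -/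
theorem exists_model :
    ∃ (D : CBData) (P : NFPoint), Hypotheses D ∧ P ∈ D.toSet ∧ P ∈ UPle 1 ∧
      ∃ A : PrimeChoiceData, A.h = logQForall P ∧ A.d = P.degree ∧ A.δ = delta P.degree ∧
        IsXiPrm A.ξ := by
  obtain ⟨ξ, hξ⟩ := exists_isXiPrm
  obtain ⟨D, hD, hlarge⟩ := exists_hypotheses_unbounded_logQForall
  obtain ⟨P, hPD, hPU, hH⟩ := hlarge (ξ ^ 2)
  have hξ0 : 0 ≤ ξ := le_trans (by norm_num) hξ.1
  have hξh : ξ ≤ Real.sqrt (logQForall P) :=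
    (Real.le_sqrt hξ0 (le_trans (sq_nonneg ξ) hH.le)).mpr hH.le
  obtain ⟨A, hA, hd, hδ, hAξ⟩ := exists_model_of_point P hξ hξh
  exact ⟨D, P, hD, hPD, hPU, A, hA, hd, hδ, hAξ ▸ hξ⟩

/-- **`Cor22.PrimeChoiceData` is inhabited at a genuine model.** [claim: Mochizuki2012, status: disputed] -/
theorem nonempty_model : Nonempty PrimeChoiceData := by
  obtain ⟨-, -, -, -, -, A, -⟩ := exists_model
  exact ⟨A⟩

/-- At that genuine datum the prime `l` of (P1)–(P3) exists (the landed `exists_prime_P1_P2_P3`,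
instantiated — it was previously quantified over a record with no kernel term). [claim: Mochizuki2012, status: disputed] -/
theorem exists_model_prime_P1 :
    ∃ (P : NFPoint) (A : PrimeChoiceData), A.h = logQForall P ∧
      ∃ l : ℕ, l.Prime ∧ Real.sqrt A.h ≤ l := by
  obtain ⟨-, P, -, -, -, A, hA, -⟩ := exists_model
  obtain ⟨l, hl, hlo, -⟩ := A.exists_prime_P1_P2_P3
  exact ⟨P, A, hA, l, hl, hlo⟩

end PrimeChoiceData

end Cor22

end Literature.IUT.LogVolume
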